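import Summits.QuantumFields.YangMills.Theorems.BalabanUVNodesN15KingModelFreePropagatorComparison

/-!
# BalabanUVNodes ∕ N15 — THE KING-MODEL RUNG (PART Ϻ-g): KING's CONTINUUM BLOCK TWO-POINT FUNCTION IS DECREASING IN EVERY COORDINATE SEPARATION —
# `|z_μ| ≤ |z′_μ| (all μ) ⇒ S₂^{ℝ}(z′) ≤ S₂^{ℝ}(z)`; in particular `S₂^{ℝ}(z) ≤ S₂^{ℝ}(0)` and `S₂^{ℝ}` decreases along every coordinate ray away from the origin
# (Track A, DAG node N15 = NE2; FAN-OUT v1.1 §N15 s3 «KING-MODEL RUNG»; uses parts Ϻ-a∕b∕c; count-neutral)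

HONEST FRAMING.  Count-neutral (cell `pub-ymgap`, seat `pub-ymgap-dag-n15-e` g35; `--supports stmt-QuantumFields-27366 --as helper` = K3⁸).  King's `A = 0`, `g = 0` model
([King1986] C. King, Commun. Math. Phys. **102** (1986) 649–677).  In part Ϻ-b's heat-kernel form `S₂^{ℝ}(z) = ∫₀^∞e^{−tm²}Π_μ J_t(z_μ)dt`, `J_t = Λ ∗ g_t` is the
convolution of two EVEN functions DECREASING in `|x|` — the tent `Λ = (1−|u|)₊` and the line heat kernel `g_t`.  Such a convolution is again even and decreasing in `|x|`
(Wintner ∕ Anderson); here the elementary route: the layer-cake formula `Λ(u) = |{s ∈ (0,1] : |u| < s}|` turns `J_t(x)` into an average of WINDOW integrals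
`W_s(x) = ∫_{x−s}^{x+s}g_t` over `s ∈ (0,1]`, and for `0 ≤ x ≤ x′`, `W_s(x) − W_s(x′) = ∫_{x−s}^{x′−s}[g_t(v) − g_t(v+2s)]dv ≥ 0` because `|v| ≤ v + 2s` there.  Hence
★★ `J_t(x′) ≤ J_t(x)` whenever `|x| ≤ |x′|`, and, multiplying over coordinates and integrating in proper time, ★★★ `S₂^{ℝ}(z′) ≤ S₂^{ℝ}(z)` whenever `|z_μ| ≤ |z′_μ|` for all
`μ`: the continuum block two-point function of King's free field is COORDINATEWISE MONOTONE (part Ϸ-m had the one-step contraction along the axes only; part Ϝ-k's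
`|S₂^{ℝ}(z)| ≤ S₂^{ℝ}(0)` came from positive-definiteness).  NOT Bałaban's objects; NOT a node discharge; nothing continuum-Yang–Mills ∕ `ℝ⁴` ∕ OS ∕ Clay.  0 `sorry`, 0 def;
standard axioms.

WHAT THIS FILE PROVES (kernel).  §1 `volumeReal_Ioi_abs_inter` (`|{s ∈ (0,1] : |u| < s}| = Λ(u)`), ★ `integral_tent_mul_eq_integral_window` (layer cake + Fubini).  §2 `setIntegral_Ioo_gaussLine_sub_eq`
(the window as `∫_{x−s}^{x+s}g_t`), ★★ `window_gaussLine_anti` (`0 ≤ x ≤ x′ ⇒ W_s(x′) ≤ W_s(x)`).  §3 `tentAvg_gaussLine_neg` (evenness), ★★ **`tentAvg_gaussLine_anti_abs`** (`|x| ≤ |x′| ⇒ J_t(x′) ≤ J_t(x)`).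
§4 ★★★ **`kingS2Inf_anti_abs`** (coordinatewise monotonicity), ★★ `kingS2Inf_le_zero_sep` (`S₂^{ℝ}(z) ≤ S₂^{ℝ}(0)`), ★★ `kingS2Inf_add_single_le` (one more step along a coordinate ray, away
from `0`, does not increase `S₂^{ℝ}`), `kingS2Inf_natAbs_eq` (`S₂^{ℝ}` depends on `(|z_μ|)_μ` only).

HONEST SCOPE.  King's free model, `m² > 0`, every `d`; monotonicity is in the coordinate absolute values (the natural order for a hypercubic block field), not in the Euclidean
radius.  N15 untouched; counts unmoved.  Locators (use): [King1986] Thm 2.1 (2.22) p.654, (4.5) p.670, Thm 3.3 (3.6) p.655.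
-/

noncomputable section

open scoped BigOperators Topology
open Filter MeasureTheory Set Function

namespace Summit.QuantumFields.YangMills.BalabanUVNodes.N15KingModelRung.ProperTime

open Summit.QuantumFields.YangMills.BalabanUVNodes.N15KingModelRung.OptimalDecay
open Literature.Analysis.Fourier (tent tent_nonneg tent_le_one tent_eq tent_eq_zero continuous_tent)

variable {d : ℕ}

/-! ## §1 Layer cake: `Λ(u) = |{s ∈ (0,1] : |u| < s}|` and `∫Λψ = ∫₀¹ (∫_{|u|<s} ψ) ds` -/

/-- `|{s ∈ (0,1] : |u| < s}| = (1−|u|)₊ = Λ(u)`. [folklore] -/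
theorem volumeReal_Ioi_abs_inter (u : ℝ) : (volume (Ioi |u| ∩ Ioc (0 : ℝ) 1)).toReal = tent 1 u := by
  have h : Ioi |u| ∩ Ioc (0 : ℝ) 1 = Ioc |u| 1 := by
    ext s
    simp only [mem_inter_iff, mem_Ioi, mem_Ioc]
    constructor
    · rintro ⟨h1, _, h3⟩; exact ⟨h1, h3⟩
    · rintro ⟨h1, h2⟩; exact ⟨h1, (abs_nonneg u).trans_lt h1, h2⟩
  rw [h, Real.volume_Ioc, ENNReal.toReal_ofReal', tent, div_one]

/-- ★ **Layer cake + Fubini**: for an integrable continuous `ψ`, `∫_ℝ Λ(u)ψ(u)du = ∫_{s∈(0,1]} ∫_{u∈(−s,s)} ψ(u)du ds`. [folklore] -/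
theorem integral_tent_mul_eq_integral_window {ψ : ℝ → ℝ} (hψc : Continuous ψ) (hψi : Integrable ψ) :
    ∫ u : ℝ, tent 1 u * ψ u = ∫ s in Ioc (0 : ℝ) 1, ∫ u in Ioo (-s) s, ψ u := by
  set G : ℝ → ℝ → ℝ := fun u s => (Ioi |u|).indicator (fun _ => ψ u) s with hG
  -- Step 1: `Λ(u)ψ(u) = ∫_{s∈(0,1]} G u s`
  have h1 : ∀ u : ℝ, tent 1 u * ψ u = ∫ s in Ioc (0 : ℝ) 1, G u s := by
    intro u
    rw [hG, integral_indicator_const _ measurableSet_Ioi, Measure.real, Measure.restrict_apply measurableSet_Ioi, volumeReal_Ioi_abs_inter, smul_eq_mul]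
  simp_rw [h1]
  -- Step 2: Fubini on `ℝ × (0,1]`
  have hT : MeasurableSet {p : ℝ × ℝ | |p.1| < p.2} := measurableSet_lt (f := fun p : ℝ × ℝ => |p.1|) (g := fun p : ℝ × ℝ => p.2) (by fun_prop) (by fun_prop)
  have hGT : uncurry G = {p : ℝ × ℝ | |p.1| < p.2}.indicator fun p => ψ p.1 := by
    funext p
    simp only [uncurry, hG, indicator, mem_Ioi, mem_setOf_eq]
  have hfin : Integrable (fun _ : ℝ => (1 : ℝ)) (volume.restrict (Ioc (0 : ℝ) 1)) :=
    integrableOn_const (by rw [Real.volume_Ioc]; exact ENNReal.ofReal_ne_top)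
  have hmaj := hψi.norm.mul_prod hfin
  have hint : Integrable (uncurry G) (volume.prod (volume.restrict (Ioc (0 : ℝ) 1))) := by
    refine hmaj.mono' ?_ (Eventually.of_forall fun p => ?_)
    · rw [hGT]
      exact (Continuous.aestronglyMeasurable (by fun_prop)).indicator hT
    · simp only [uncurry, hG, mul_one, Real.norm_eq_abs]
      by_cases hp : p.2 ∈ Ioi |p.1|
      · rw [indicator_of_mem hp]
      · rw [indicator_of_notMem hp, abs_zero]; exact abs_nonneg _
  rw [integral_integral_swap hint]
  -- Step 3: at fixed `s`, `u ↦ G u s` is `ψ` restricted to the window `(−s, s)`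
  refine setIntegral_congr_fun measurableSet_Ioc fun s _ => ?_
  have hGs : (fun u : ℝ => G u s) = (Ioo (-s) s).indicator ψ := by
    funext u
    simp only [hG, indicator, mem_Ioi, mem_Ioo, abs_lt]
  rw [hGs, integral_indicator measurableSet_Ioo]

/-! ## §2 The windows of the heat kernel are decreasing in the centre -/

/-- The window in interval form: `∫_{u∈(−s,s)} g_t(x − u)du = ∫_{x−s}^{x+s} g_t` (`s ≥ 0`). [folklore] -/
theorem setIntegral_Ioo_gaussLine_sub_eq {t s : ℝ} (hs : 0 ≤ s) (x : ℝ) :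
    ∫ u in Ioo (-s) s, gaussLine t (x - u) = ∫ v in (x - s)..(x + s), gaussLine t v := by
  rw [← integral_Ioc_eq_integral_Ioo, ← intervalIntegral.integral_of_le (by linarith : -s ≤ s),
    intervalIntegral.integral_comp_sub_left (fun v => gaussLine t v) x]
  simp only [sub_neg_eq_add]

/-- ★★ **WINDOW MONOTONICITY**: for `t > 0`, `s ≥ 0`, `0 ≤ x ≤ x′`: `∫_{x′−s}^{x′+s} g_t ≤ ∫_{x−s}^{x+s} g_t`
(`W_s(x) − W_s(x′) = ∫_{x−s}^{x′−s}[g_t(v) − g_t(v+2s)]dv ≥ 0`, as `|v| ≤ v + 2s` on `v ≥ −s`). [folklore] -/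
theorem window_gaussLine_anti {t s x x' : ℝ} (ht : 0 < t) (hs : 0 ≤ s) (hx : 0 ≤ x) (hxx : x ≤ x') :
    ∫ v in (x' - s)..(x' + s), gaussLine t v ≤ ∫ v in (x - s)..(x + s), gaussLine t v := by
  have hii : ∀ a b : ℝ, IntervalIntegrable (gaussLine t) volume a b := fun a b => (continuous_gaussLine t).intervalIntegrable a b
  -- `W(x) + ∫_{x+s}^{x'+s} = ∫_{x−s}^{x'+s} = ∫_{x−s}^{x'−s} + W(x')`
  have h1 := intervalIntegral.integral_add_adjacent_intervals (hii (x - s) (x + s)) (hii (x + s) (x' + s))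
  have h2 := intervalIntegral.integral_add_adjacent_intervals (hii (x - s) (x' - s)) (hii (x' - s) (x' + s))
  -- the shifted piece
  have hshift : ∫ v in (x + s)..(x' + s), gaussLine t v = ∫ v in (x - s)..(x' - s), gaussLine t (v + 2 * s) := by
    rw [intervalIntegral.integral_comp_add_right (fun v => gaussLine t v)]
    congr 1 <;> ring
  have hnonneg : 0 ≤ ∫ v in (x - s)..(x' - s), (gaussLine t v - gaussLine t (v + 2 * s)) := by
    refine intervalIntegral.integral_nonneg (by linarith) fun v hv => ?_
    rw [sub_nonneg]
    refine gaussLine_anti ht ?_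
    rw [abs_of_nonneg (by linarith [hv.1] : 0 ≤ v + 2 * s), abs_le]
    constructor <;> linarith [hv.1]
  have hsub : ∫ v in (x - s)..(x' - s), (gaussLine t v - gaussLine t (v + 2 * s))
      = (∫ v in (x - s)..(x' - s), gaussLine t v) - ∫ v in (x - s)..(x' - s), gaussLine t (v + 2 * s) :=
    intervalIntegral.integral_sub (hii _ _) (((continuous_gaussLine t).comp (continuous_add_const _)).intervalIntegrable _ _)
  rw [hsub, ← hshift] at hnonneg
  linarith

/-! ## §3 `J_t = Λ ∗ g_t` is even and decreasing in `|x|` -/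

/-- `J_t` is even. [folklore] -/
theorem tentAvg_gaussLine_neg {t : ℝ} (ht : 0 < t) (x : ℝ) :
    ∫ u : ℝ, tent 1 u * gaussLine t (-x - u) = ∫ u : ℝ, tent 1 u * gaussLine t (x - u) := by
  rw [tentAvg_eq_lineHeat_div ht, tentAvg_eq_lineHeat_div ht, lineHeat_neg]

/-- `J_t` on `[0,∞)` is decreasing: `0 ≤ x ≤ x′ ⇒ J_t(x′) ≤ J_t(x)`. [folklore] -/
theorem tentAvg_gaussLine_anti {t x x' : ℝ} (ht : 0 < t) (hx : 0 ≤ x) (hxx : x ≤ x') :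
    ∫ u : ℝ, tent 1 u * gaussLine t (x' - u) ≤ ∫ u : ℝ, tent 1 u * gaussLine t (x - u) := by
  have hψ : ∀ y : ℝ, Continuous (fun u : ℝ => gaussLine t (y - u)) ∧ Integrable (fun u : ℝ => gaussLine t (y - u)) := fun y =>
    ⟨(continuous_gaussLine t).comp (continuous_const.sub continuous_id), (integrable_gaussLine ht).comp_sub_left y⟩
  rw [integral_tent_mul_eq_integral_window (hψ x').1 (hψ x').2, integral_tent_mul_eq_integral_window (hψ x).1 (hψ x).2]
  -- integrability of the window functions on `(0,1]` via Fubini's other half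
  have hwin : ∀ y : ℝ, IntegrableOn (fun s : ℝ => ∫ u in Ioo (-s) s, gaussLine t (y - u)) (Ioc (0 : ℝ) 1) := by
    intro y
    have hT : MeasurableSet {p : ℝ × ℝ | |p.1| < p.2} := measurableSet_lt (f := fun p : ℝ × ℝ => |p.1|) (g := fun p : ℝ × ℝ => p.2) (by fun_prop) (by fun_prop)
    have hfin : Integrable (fun _ : ℝ => (1 : ℝ)) (volume.restrict (Ioc (0 : ℝ) 1)) :=
      integrableOn_const (by rw [Real.volume_Ioc]; exact ENNReal.ofReal_ne_top)
    have hmaj := (hψ y).2.norm.mul_prod hfin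
    have hint : Integrable ({p : ℝ × ℝ | |p.1| < p.2}.indicator fun p => gaussLine t (y - p.1)) (volume.prod (volume.restrict (Ioc (0 : ℝ) 1))) := by
      refine hmaj.mono' (((continuous_gaussLine t).comp (continuous_const.sub continuous_fst)).aestronglyMeasurable.indicator hT) (Eventually.of_forall fun p => ?_)
      simp only [mul_one, Real.norm_eq_abs]
      by_cases hp : p ∈ {p : ℝ × ℝ | |p.1| < p.2}
      · rw [indicator_of_mem hp]
      · rw [indicator_of_notMem hp, abs_zero]; exact abs_nonneg _
    have h := hint.integral_prod_right
    refine h.congr (Eventually.of_forall fun s => ?_)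
    simp only
    rw [← integral_indicator measurableSet_Ioo]
    refine integral_congr_ae (Eventually.of_forall fun u => ?_)
    simp only [indicator, mem_setOf_eq, mem_Ioo, abs_lt]
  refine setIntegral_mono_on (hwin x') (hwin x) measurableSet_Ioc fun s hs => ?_
  rw [setIntegral_Ioo_gaussLine_sub_eq hs.1.le, setIntegral_Ioo_gaussLine_sub_eq hs.1.le]
  exact window_gaussLine_anti ht hs.1.le hx hxx

/-- ★★ **`J_t(x′) ≤ J_t(x)` whenever `|x| ≤ |x′|`** (`t > 0`): the tent-smeared heat kernel is even and decreasing in `|x|`. [folklore] -/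
theorem tentAvg_gaussLine_anti_abs {t x x' : ℝ} (ht : 0 < t) (h : |x| ≤ |x'|) :
    ∫ u : ℝ, tent 1 u * gaussLine t (x' - u) ≤ ∫ u : ℝ, tent 1 u * gaussLine t (x - u) := by
  have hex : ∀ y : ℝ, ∫ u : ℝ, tent 1 u * gaussLine t (y - u) = ∫ u : ℝ, tent 1 u * gaussLine t (|y| - u) := by
    intro y
    rcases le_or_gt 0 y with hy | hy
    · rw [abs_of_nonneg hy]
    · rw [abs_of_neg hy, tentAvg_gaussLine_neg ht]
  rw [hex x, hex x']
  exact tentAvg_gaussLine_anti ht (abs_nonneg x) h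

/-! ## §4 Coordinatewise monotonicity of `S₂^{ℝ}` -/

/-- ★★★ **KING's CONTINUUM BLOCK TWO-POINT FUNCTION IS DECREASING IN EVERY COORDINATE SEPARATION**: if `|z_μ| ≤ |z′_μ|` for all `μ` then `S₂^{ℝ}(z′) ≤ S₂^{ℝ}(z)`
(`m² > 0`, every `d`). [cite: King1986, Thm 2.1 (2.22) p.654, (4.5) p.670; folklore (Wintner–Anderson unimodality)] -/
theorem kingS2Inf_anti_abs {m2 : ℝ} (hm : 0 < m2) {z z' : Fin (d + 1) → ℤ} (h : ∀ μ, |z μ| ≤ |z' μ|) : kingS2Inf m2 z' ≤ kingS2Inf m2 z := by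
  rw [kingS2Inf_eq_integral_tent_gaussLine hm z, kingS2Inf_eq_integral_tent_gaussLine hm z']
  refine setIntegral_mono_on (integrableOn_tentForm hm z') (integrableOn_tentForm hm z) measurableSet_Ioi fun t ht => ?_
  refine mul_le_mul_of_nonneg_left ?_ (Real.exp_nonneg _)
  refine Finset.prod_le_prod (fun μ _ => tentAvg_nonneg _ _) fun μ _ => tentAvg_gaussLine_anti_abs ht ?_
  have := h μ
  rw [← Int.cast_abs, ← Int.cast_abs]
  exact_mod_cast this

/-- ★★ `S₂^{ℝ}(z) ≤ S₂^{ℝ}(0)` for every `z` (here from monotonicity; part Ϝ-k had `|S₂^{ℝ}(z)| ≤ S₂^{ℝ}(0)` from positive-definiteness). [cite: King1986, Thm 2.1 (2.22) p.654] -/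
theorem kingS2Inf_le_zero_sep {m2 : ℝ} (hm : 0 < m2) (z : Fin (d + 1) → ℤ) : kingS2Inf m2 z ≤ kingS2Inf m2 (0 : Fin (d + 1) → ℤ) :=
  kingS2Inf_anti_abs hm fun μ => by simp

/-- `S₂^{ℝ}` depends on the coordinate absolute values only: `S₂^{ℝ}(z) = S₂^{ℝ}((|z_μ|)_μ)`. [folklore] -/
theorem kingS2Inf_natAbs_eq {m2 : ℝ} (hm : 0 < m2) (z : Fin (d + 1) → ℤ) : kingS2Inf m2 (fun μ => |z μ|) = kingS2Inf m2 z :=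
  le_antisymm (kingS2Inf_anti_abs hm fun μ => by rw [abs_abs]) (kingS2Inf_anti_abs hm fun μ => by rw [abs_abs])

/-- ★★ **One more step away from the origin along a coordinate does not increase `S₂^{ℝ}`**: if `0 ≤ z_ν` then `S₂^{ℝ}(z + e_ν) ≤ S₂^{ℝ}(z)` (every other coordinate fixed;
part Ϸ-m's strict contraction `≤ e^{−m}·` was along the axes only). [cite: King1986, Thm 2.1 (2.22) p.654, Thm 3.3 (3.6) p.655] -/
theorem kingS2Inf_add_single_le {m2 : ℝ} (hm : 0 < m2) {z : Fin (d + 1) → ℤ} {ν : Fin (d + 1)} (hz : 0 ≤ z ν) :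
    kingS2Inf m2 (z + Pi.single ν 1) ≤ kingS2Inf m2 z := by
  refine kingS2Inf_anti_abs hm fun μ => ?_
  by_cases hμ : μ = ν
  · subst hμ
    rw [Pi.add_apply, Pi.single_eq_same, abs_of_nonneg hz, abs_of_nonneg (by linarith)]
    linarith
  · rw [Pi.add_apply, Pi.single_eq_of_ne hμ, add_zero]

end Summit.QuantumFields.YangMills.BalabanUVNodes.N15KingModelRung.ProperTime
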